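import Literature.AnabelianGeometry.SemiGraphs.PSCGraphicitySub2
import Literature.AnabelianGeometry.SemiGraphs.PSCSeparatingCoveringsProofs
import Mathlib.Topology.Algebra.ClopenNhdofOne
import HarnessLib

/-!
# [CombGC] Theorem 1.6 sub-DAG, row T16-L14: unramified verticial subgroups are vertex stabilizers

[IUTchI] Remark 1.2.3 (iv) (kurims p. 42): "in order to characterize the unramified verticial
subgroups of `Π^unr_G`, it suffices — by considering stabilizers of vertices of underlying semi-graphs
of finite étale `Π^unr_G`-coverings of `G` — to give a functorial characterization of the set of
vertices of `G`".  Over abc-iut-L3-t4's interface this reduction is the statement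
`PSCDatum.UnrVerticialEqVertexStabilizer` of `PSCGraphicitySub2.lean` (abc-iut-w4-d052, statements II):
the unramified verticial subgroups `Π_v^γ · Ker(Π_G ↠ Π^unr_G)` are exactly the intersections
`⋂_U (U · Π_v^γ)` over the open normal `U ⊇ Ker(Π_G ↠ Π^unr_G)` (the stabilizers of the compatible
systems of vertices `U γ Π_v` of the coverings `G_U`).  PROVED here for profinite `Π_G` — closed
subgroups of a profinite group are the intersections of their open-normal neighbourhoods:

* `smul_vertGp_sup_unrKer_eq_iInf` — `Π_v^γ · Ker = ⋂_U (U ⊔ Π_v^γ)`;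
* `unrVerticialEqVertexStabilizer` — `G.UnrVerticialEqVertexStabilizer` for every datum `G` on a
  profinite group.

Proof-only (0 defs); plain profinite group theory; nothing here takes a side on [IUTchIII] Cor. 3.12.
[cite: Mochizuki2012, IUTchI Rmk 1.2.3(iv) p.42]
-/

noncomputable section

namespace Literature.AnabelianGeometry.SemiGraphs

namespace PSCDatum

open scoped Pointwise

universe u

variable {P : Type u} [Group P] [TopologicalSpace P] [IsTopologicalGroup P]
  [CompactSpace P] [T2Space P] [TotallyDisconnectedSpace P]

/-- In a profinite group, the closed subgroup `Π_v^γ · Ker(Π_G ↠ Π^unr_G)` is the intersection of the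
subgroups `U · Π_v^γ` over the open normal subgroups `U ⊇ Ker(Π_G ↠ Π^unr_G)` — the stabilizers of the
vertices `U γ Π_v` of the `Π^unr_G`-coverings `G_U` lying under the system determined by `(v, γ)`.
[cite: Mochizuki2012, IUTchI Rmk 1.2.3(iv) p.42] -/
theorem smul_vertGp_sup_unrKer_eq_iInf (G : PSCDatum P) (v : G.graph.V) (γ : ConjAct P) :
    γ • G.vertGp v ⊔ G.unrKer =
      ⨅ U : {U : Subgroup P // U.Normal ∧ IsOpen (U : Set P) ∧ G.unrKer ≤ U},
        (U.1 ⊔ γ • G.vertGp v) := by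
  set H : Subgroup P := γ • G.vertGp v ⊔ G.unrKer with hH
  refine le_antisymm (le_iInf fun U => sup_le le_sup_right (U.2.2.2.trans le_sup_left)) ?_
  intro x hx
  -- `H` is closed: the product of the compact sets `Π_v^γ` and `Ker`.
  have hAc : IsClosed ((γ • G.vertGp v : Subgroup P) : Set P) :=
    isClosed_conj_smul (G.isClosed_vertGp v) γ
  have hKc : IsClosed (G.unrKer : Set P) := Subgroup.isClosed_topologicalClosure _
  have hHc : IsClosed (H : Set P) := by
    have hset : (H : Set P) = ((γ • G.vertGp v : Subgroup P) : Set P) * (G.unrKer : Set P) := by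
      rw [hH, Subgroup.mul_normal]
    rw [hset, ← Set.image_mul_prod]
    exact ((hAc.isCompact.prod hKc.isCompact).image continuous_mul).isClosed
  by_contra hxH
  -- an open normal `U₀` with `U₀ · x` disjoint from `H`
  have hO : IsOpen {u : P | u * x ∈ (H : Set P)ᶜ} :=
    hHc.isOpen_compl.preimage (continuous_id.mul continuous_const)
  obtain ⟨U₀, hU₀⟩ := ProfiniteGrp.exist_openNormalSubgroup_sub_open_nhds_of_one hO
    (by simpa using hxH)
  -- the open normal subgroup `U := U₀ · Ker ⊇ Ker`
  have hUn : ((U₀ : Subgroup P) ⊔ G.unrKer).Normal := inferInstance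
  have hUo : IsOpen (((U₀ : Subgroup P) ⊔ G.unrKer : Subgroup P) : Set P) :=
    Subgroup.isOpen_mono le_sup_left U₀.isOpen
  have hxU := (Subgroup.mem_iInf.mp hx) ⟨(U₀ : Subgroup P) ⊔ G.unrKer, hUn, hUo, le_sup_right⟩
  -- `(U₀ ⊔ Ker) ⊔ Π_v^γ = U₀ ⊔ H = U₀ * H`
  have hxU' : x ∈ (((U₀ : Subgroup P) ⊔ H : Subgroup P) : Set P) := by
    rw [hH, ← sup_assoc, sup_right_comm]
    exact hxU
  rw [Subgroup.normal_mul] at hxU'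
  obtain ⟨u, hu, h, hh, rfl⟩ := hxU'
  have hu' : u⁻¹ ∈ (U₀ : Set P) := inv_mem hu
  have := hU₀ hu'
  simp only [Set.mem_setOf_eq, Set.mem_compl_iff, SetLike.mem_coe, inv_mul_cancel_left] at this
  exact this hh

/-- **Row T16-L14 of the cell's sub-DAG for [CombGC] Thm. 1.6**: over a profinite group, the unramified
verticial subgroups are exactly the stabilizers of compatible systems of vertices of the
`Π^unr_G`-coverings ([IUTchI] Rmk. 1.2.3 (iv), p. 42: "by considering stabilizers of vertices of
underlying semi-graphs of finite étale `Π^unr_G`-coverings of `G`"). [cite: Mochizuki2012, IUTchI Rmk 1.2.3(iv) p.42] -/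
theorem unrVerticialEqVertexStabilizer (G : PSCDatum P) : G.UnrVerticialEqVertexStabilizer := by
  intro B
  constructor
  · rintro ⟨A, ⟨v, γ, rfl⟩, rfl⟩
    exact ⟨v, γ, G.smul_vertGp_sup_unrKer_eq_iInf v γ⟩
  · rintro ⟨v, γ, rfl⟩
    exact ⟨γ • G.vertGp v, ⟨v, γ, rfl⟩, (G.smul_vertGp_sup_unrKer_eq_iInf v γ).symm⟩

end PSCDatum

end Literature.AnabelianGeometry.SemiGraphs

end
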